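/-
Copyright: cell `pub-ymgap` (HUMAN RULING D-0062), Track A of `YM-PLAN.md`, DAG node N20 (= NE7b); R134 acceleration seat
`pub-ymgap-dag-n20-c` (strategy s1, generation 4), module 21.  Released under the licence of the surrounding project.
-/
import Summits.QuantumFields.YangMills.Theorems.BalabanUVNodesN20LCSAtTStepOfRecord
import Summits.QuantumFields.YangMills.Theorems.BalabanUVNodesN20LCSLargeFieldFamilies
import HarnessLib

/-!
# YM-DAG node N20 (= NE7b), strategy s1, module 21: THE LABEL PIECES OF NODE 00's T-STEP — `hstep` for label-indexed choices, and «hrel» at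
# the first pinned step IN THE TOWER's CURRENCY (level-1 masses of the pinned label pieces against the level-0 mass)

Track A of `YM-PLAN.md` (cell `pub-ymgap`, HUMAN RULING D-0062), node **N20** = spine estimate NE7b (`T4WeightBudget.RelWeightBound` — NOT PRINTED,
NOT PROVED).  Seat `pub-ymgap-dag-n20-c` (R134, s1), generation 4, module 21 (17–20 = `…N20LCSLargeField{Labels,FirstStep,Families,Halves}`).  Kernel
theorems only: 0 `def`, 0 `sorry`, standard axioms; COUNT-NEUTRAL; `--supports` the K3‴ item.  Nothing of Bałaban's is asserted.

WHY.  The (α)-road's one-step display `hrel` (`PrefixExtraction.hrel_of_hstep`) lives in the TOWER's currency — level-`(j+1)` masses of the pinned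
pieces `∫ (op j g p)(eterm) dμ_{j+1}` on the left, the level-`j` mass on the right — and is derived from the `hstep` identities
`∫ (op p) f dμ_{j+1} = ∫ χ_p·f dμ_j` plus the two halves.  Modules 17–20 worked on the GRAPH (level-`k` integrals).  Module 19's DESIGN INPUT: an instance
that extracts the pinned large-field event by (3.2) indexes its step choices by print's LABELS `t = (P,Q,R,S)_{k+1}` (def-T's `LbOfRecord`), the piece of
the label `t` after the old sequence `s` being NODE 00's value-level T-step (†) with the step weight `ω s t` and the new sequence `σ s t`:
`χ_{k+1}(σ s t)(V′)·texpASucc avOfRecord χ_k T (ω s t) (σ s t)(V′)`.  THIS FILE supplies, for these LABEL PIECES: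
* §1 `abs_ωOfRecord_le_one` (`|ω s t| ≤ 1`, one term of def-T's `sum_abs_ωOfRecord_le_one`);
* §2 ★ **`integral_mul_labelPiece`** ∕ **`integral_labelPiece`** — module 3's graph identity AT ONE LABEL (the front factor absorbed by `front_absorb`,
  `(σ s t).init = s`): `∫ M(V′)·χ_{k+1}(σ s t)(V′)·(piece of t)(V′) dV′ = ∫ M(Ū)·ω s t(U,Ū)·(χ_k(s)(U)·T(s)(U)) dU` — i.e. **`hstep` FOR THE LABEL
  CHOICE `t` WITH STEP KERNEL `U ↦ ω s t (U, Ū)`** (IR-102-1's row, at the record, per label; displayed provisos: performed level `k < K`, integrable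
  old piece, jointly measurable label weight (O4), measurable new front factor); `integrable_labelFine`; §2b **`sum_ωOfRecord_eq_one`** (the `hunit`
  row for label choices: `Σ_t ω s t (U,V′) = 1`, modulo `IsZetaUnity`) and **`sum_integral_labelPiece_eq`** (the `hpres` row: the level-`(k+1)` masses
  of all label pieces add up to the old piece's level-`k` mass);
* §3 ★★★ **`abs_sum_integral_pinnedLabelPieces_le`** — THE FIRST PINNED STEP IN THE TOWER's CURRENCY: from the one-term representation `ρ₀` of
  level `0` (`χ_0 ≡ 1`, `chiSeqOfRecord_zero`), the SUM OVER THE PINNED LABEL CHOICES (new large-field family `⊇ D`) OF THE LEVEL-`1` MASSES OF THEIR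
  PIECES is at most `(m·e^{Cδ₀ − δ₀g₀⁻²ε″²∕(2N)})^{#D}·∫ρ₀ dU` (module 19 after §2 and `Σ∫ = ∫Σ`) — the conclusion shape
  `Σ_{p ∈ branch ∩ S} ∫ (op p ρ₀) dμ₁ ≤ ε_{0}·∫ ρ₀ dμ₀` of `hrel_of_hstep` at `j = 0`, with `ε_0 = (m·r)^{#D}`, for label-indexed choices.

HONEST FRAMING.  Conditional on the DISPLAYED letters (`IsZetaAbsLeOne`; the [Balaban1985PropagatorsII] Thm 1 regularity letter per pinned cube —
NOT asserted), on the displayed measurabilities ((O4): def-R's (2.12) minimiser has no measurable selection in the tree), on disjoint letter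
regions; first step only for §3 (at `j ≥ 1` the right member needs «LCS-j» in the old term's own state — the located residual, (A1c)); the tower
OBJECT (ops as `RelLinPosHom`, good classes, positivity of `ζ`) is NOT built here (planners' ∕ (A1c)'s).  NE7b NOT PRINTED ∕ NOT PROVED; (α)-instance
0∕1; N20 NOT discharged; typed 28∕28, discharged count untouched; one finite four-torus at fixed `ε` — NOT ℝ⁴, NOT infinite volume, NOT OS, NOT a mass
gap, NOT Clay.

References: T. Bałaban, CMP 119 (1988) 243–285 [Balaban1988Convergent] ((3.1) p. 264, (3.2)–(3.5) p. 265, (3.24)–(3.25) p. 270); CMP 122 (1989)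
175–202 [Balaban1989LargeFieldI] ((0.3)–(0.4) p. 176, (1.22)–(1.28) pp. 181–183); CMP 99 (1985) 389–434 [Balaban1985PropagatorsII] (Thm 1).
-/

set_option autoImplicit false

noncomputable section

open scoped BigOperators

namespace Summit.QuantumFields.YangMills.BalabanUVNodes.N20LCSLabelPieces

open MeasureTheory
open Literature.MathematicalPhysics.QuantumFieldTheory.Balaban1983to89
open Literature.MathematicalPhysics.QuantumFieldTheory.Balaban1983to89.T4Continuum
open Literature.MathematicalPhysics.QuantumFieldTheory.Balaban1983to89.Node00
open Summit.QuantumFields.YangMills.BalabanUVNodes.N20LCSAtTStepOfRecord (integral_mul_piece_texpASucc integrable_finePiece)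
open Summit.QuantumFields.YangMills.BalabanUVNodes.N20LCSLargeFieldLabels (front_mul_ωOfRecord)
open Summit.QuantumFields.YangMills.BalabanUVNodes.N20LCSLargeFieldFamilies (abs_integral_pinnedLargeFamily_rhoZero_le)

variable (F : T4Family) (N : ℕ) [NeZero N] (ν : Stage7Numerics) (M : ℕ) (p : B12.RunParams) (g : ℕ → ℝ) (k : ℕ)

/-! ## §1 One label weight is bounded by one -/

/-- `|ω s t (U,V′)| ≤ 1` for every single label, modulo `IsZetaAbsLeOne` (one term of `sum_abs_ωOfRecord_le_one`). [folklore] -/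
theorem abs_ωOfRecord_le_one (A₁ : ℝ) {ζ : ZetaOfRecord F N ν M} (hζ : IsZetaAbsLeOne F N ν M ζ)
    (s : SeqOfRecord F ν M g p.K k) (t : LbOfRecord F ν p g k)
    (U : GaugeField (F.P p.K) k (SU N)) (V' : GaugeField (F.P p.K) (k + 1) (SU N)) :
    |ωOfRecord F N ν M p g k A₁ ζ s t U V'| ≤ 1 :=
  (Finset.single_le_sum (f := fun t' => |ωOfRecord F N ν M p g k A₁ ζ s t' U V'|) (fun _ _ => abs_nonneg _)
    (Finset.mem_univ t)).trans (sum_abs_ωOfRecord_le_one F N ν M p g k A₁ hζ s U V')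

/-! ## §2 The label piece of the T-step: a coarse carrier against it is the carrier on the graph against `ω s t·(χ_k(s)·T(s))` -/

/-- **A COARSE CARRIER AGAINST THE LABEL PIECE IS THE COMPOSED CARRIER AGAINST THE LABEL's FINE DENSITY** (module 3's graph form at ONE label:
the step weight is the label weight `ω s t`, the new sequence is `σ s t`, whose front factor is absorbed by `ω s t`): at a performed level `k < K`, for a
bounded measurable coarse carrier `M`, an integrable old piece `χ_k(s)·T(s)`, a jointly measurable label weight (displayed, (O4)) and a measurable new
front factor (displayed),
`∫ M(V′)·χ_{k+1}(σ s t)(V′)·(𝐓-piece of the label t)(V′) dV′ = ∫ M(Ū)·ω s t (U,Ū)·(χ_k(s)(U)·T(s)(U)) dU`. [folklore] -/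
theorem integral_mul_labelPiece (hk : k < p.K) (A₁ : ℝ) {ζ : ZetaOfRecord F N ν M} (hζ : IsZetaAbsLeOne F N ν M ζ)
    (T : SeqOfRecord F ν M g p.K k → Density (F.P p.K) k (SU N)) (s : SeqOfRecord F ν M g p.K k) (t : LbOfRecord F ν p g k)
    (hT : Integrable (fun U => chiSeqOfRecord F N ν M g p.K k s U * T s U) (fieldMeasure (F.P p.K) k (SU N)))
    (hω : Measurable (fun z : GaugeField (F.P p.K) (k + 1) (SU N) × GaugeField (F.P p.K) k (SU N) =>
      ωOfRecord F N ν M p g k A₁ ζ s t z.2 z.1))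
    (hχ : Measurable (chiSeqOfRecord F N ν M g p.K (k + 1) (σOfRecord F ν M p g k s t)))
    {Mc : GaugeField (F.P p.K) (k + 1) (SU N) → ℝ} (hM : Measurable Mc) {C : ℝ} (hMC : ∀ V', |Mc V'| ≤ C) :
    ∫ V', Mc V' * (chiSeqOfRecord F N ν M g p.K (k + 1) (σOfRecord F ν M p g k s t) V' *
        texpASucc (avOfRecord F N p.K k).avg (chiSeqOfRecord F N ν M g p.K k) T
          (fun _ => ωOfRecord F N ν M p g k A₁ ζ s t) (σOfRecord F ν M p g k s t) V') ∂(fieldMeasure (F.P p.K) (k + 1) (SU N)) =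
      ∫ U, Mc ((avOfRecord F N p.K k).avg U) * ωOfRecord F N ν M p g k A₁ ζ s t U ((avOfRecord F N p.K k).avg U) *
          (chiSeqOfRecord F N ν M g p.K k s U * T s U) ∂(fieldMeasure (F.P p.K) k (SU N)) := by
  have hT' : Integrable (fun U => chiSeqOfRecord F N ν M g p.K k (σOfRecord F ν M p g k s t).init U *
      T (σOfRecord F ν M p g k s t).init U) (fieldMeasure (F.P p.K) k (SU N)) := by
    simpa only [init_σOfRecord] using hT
  have h := integral_mul_piece_texpASucc (avOfRecord_measurable F N p.K k) (avOfRecord_haarAC F N p.K k hk)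
    (chiSeqOfRecord F N ν M g p.K k) T (chiSeqOfRecord F N ν M g p.K (k + 1))
    (fun _ => ωOfRecord F N ν M p g k A₁ ζ s t) (σOfRecord F ν M p g k s t) hT' hω
    (fun U V' => abs_ωOfRecord_le_one F N ν M p g k A₁ hζ s t U V') hχ
    (fun V' => abs_chiSeqOfRecord_le_one F N ν M g p.K (k + 1) _ V') hM hMC
  rw [h]
  refine integral_congr_ae (ae_of_all _ fun U => ?_)
  simp only [init_σOfRecord, front_mul_ωOfRecord]

/-- **`hstep` FOR A LABEL-INDEXED CHOICE** (the per-(step, choice) integral identity the (α)-road displays, IR-102-1's currency, at the label `t` of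
NODE 00's T-step): `∫ χ_{k+1}(σ s t)·(𝐓-piece of t)·f dV′`-type identities reduce, for the mass (`M = 1`), to
`∫ χ_{k+1}(σ s t)(V′)·(𝐓-piece of t)(V′) dV′ = ∫ ω s t (U,Ū)·(χ_k(s)(U)·T(s)(U)) dU` — the step kernel of the label choice `t` is `U ↦ ω s t (U, Ū)`.
[folklore] -/
theorem integral_labelPiece (hk : k < p.K) (A₁ : ℝ) {ζ : ZetaOfRecord F N ν M} (hζ : IsZetaAbsLeOne F N ν M ζ)
    (T : SeqOfRecord F ν M g p.K k → Density (F.P p.K) k (SU N)) (s : SeqOfRecord F ν M g p.K k) (t : LbOfRecord F ν p g k)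
    (hT : Integrable (fun U => chiSeqOfRecord F N ν M g p.K k s U * T s U) (fieldMeasure (F.P p.K) k (SU N)))
    (hω : Measurable (fun z : GaugeField (F.P p.K) (k + 1) (SU N) × GaugeField (F.P p.K) k (SU N) =>
      ωOfRecord F N ν M p g k A₁ ζ s t z.2 z.1))
    (hχ : Measurable (chiSeqOfRecord F N ν M g p.K (k + 1) (σOfRecord F ν M p g k s t))) :
    ∫ V', chiSeqOfRecord F N ν M g p.K (k + 1) (σOfRecord F ν M p g k s t) V' *
        texpASucc (avOfRecord F N p.K k).avg (chiSeqOfRecord F N ν M g p.K k) T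
          (fun _ => ωOfRecord F N ν M p g k A₁ ζ s t) (σOfRecord F ν M p g k s t) V' ∂(fieldMeasure (F.P p.K) (k + 1) (SU N)) =
      ∫ U, ωOfRecord F N ν M p g k A₁ ζ s t U ((avOfRecord F N p.K k).avg U) *
          (chiSeqOfRecord F N ν M g p.K k s U * T s U) ∂(fieldMeasure (F.P p.K) k (SU N)) := by
  have h := integral_mul_labelPiece F N ν M p g k hk A₁ hζ T s t hT hω hχ (Mc := fun _ => (1 : ℝ)) measurable_const
    (C := 1) (fun _ => by simp)
  simpa only [one_mul] using h

/-- The label's fine density `ω s t (U,Ū)·(χ_k(s)(U)·T(s)(U))` is integrable (integrable old piece, bounded measurable label weight on the graph).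
[folklore] -/
theorem integrable_labelFine (A₁ : ℝ) {ζ : ZetaOfRecord F N ν M} (hζ : IsZetaAbsLeOne F N ν M ζ)
    (T : SeqOfRecord F ν M g p.K k → Density (F.P p.K) k (SU N)) (s : SeqOfRecord F ν M g p.K k) (t : LbOfRecord F ν p g k)
    (hT : Integrable (fun U => chiSeqOfRecord F N ν M g p.K k s U * T s U) (fieldMeasure (F.P p.K) k (SU N)))
    (hω : Measurable (fun z : GaugeField (F.P p.K) (k + 1) (SU N) × GaugeField (F.P p.K) k (SU N) =>
      ωOfRecord F N ν M p g k A₁ ζ s t z.2 z.1)) :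
    Integrable (fun U => ωOfRecord F N ν M p g k A₁ ζ s t U ((avOfRecord F N p.K k).avg U) *
      (chiSeqOfRecord F N ν M g p.K k s U * T s U)) (fieldMeasure (F.P p.K) k (SU N)) := by
  have hb : Measurable (fun z : GaugeField (F.P p.K) (k + 1) (SU N) × GaugeField (F.P p.K) k (SU N) =>
      ωOfRecord F N ν M p g k A₁ ζ s t z.2 z.1 * (1 : ℝ)) := hω.mul measurable_const
  have h := integrable_graph_piece (avOfRecord_measurable F N p.K k) hT hb (C := 1) (fun z => by
    rw [Real.norm_eq_abs, mul_one]; exact abs_ωOfRecord_le_one F N ν M p g k A₁ hζ s t z.2 z.1)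
  refine h.congr (ae_of_all _ fun U => ?_)
  show (chiSeqOfRecord F N ν M g p.K k s U * T s U) * (ωOfRecord F N ν M p g k A₁ ζ s t U ((avOfRecord F N p.K k).avg U) * 1) = _
  ring

/-! ## §2b The decomposition of unity and mass preservation for label-indexed choices (`hunit`, `hpres`) -/

/-- **`hunit` FOR LABEL-INDEXED CHOICES**: modulo the displayed unity law of the residual fluctuation factor (`IsZetaUnity`), the label step kernels are a
DECOMPOSITION OF UNITY pointwise in `(U, V′)`: `Σ_t ω s t (U,V′) = 1` (def-T's `labelUnity_ωOfRecord` with every front factor absorbed). [folklore] -/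
theorem sum_ωOfRecord_eq_one (A₁ : ℝ) {ζ : ZetaOfRecord F N ν M} (hζu : IsZetaUnity F N ν M ζ)
    (s : SeqOfRecord F ν M g p.K k) (U : GaugeField (F.P p.K) k (SU N)) (V' : GaugeField (F.P p.K) (k + 1) (SU N)) :
    ∑ t : LbOfRecord F ν p g k, ωOfRecord F N ν M p g k A₁ ζ s t U V' = 1 := by
  have h := labelUnity_ωOfRecord F N ν M p g k A₁ hζu s U V'
  simpa only [front_mul_ωOfRecord] using h

/-- **`hpres` FOR LABEL-INDEXED CHOICES** (mass preservation of the T-step, label by label): at a performed level `k < K`, modulo `IsZetaUnity`,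
`IsZetaAbsLeOne` and the displayed measurabilities, the level-`(k+1)` masses of ALL label pieces grown from the old piece `χ_k(s)·T(s)` add up to its
level-`k` mass: `Σ_t ∫ χ_{k+1}(σ s t)·(piece of t) dV′ = ∫ χ_k(s)(U)·T(s)(U) dU`. [folklore] -/
theorem sum_integral_labelPiece_eq (hk : k < p.K) (A₁ : ℝ) {ζ : ZetaOfRecord F N ν M} (hζu : IsZetaUnity F N ν M ζ)
    (hζ : IsZetaAbsLeOne F N ν M ζ) (T : SeqOfRecord F ν M g p.K k → Density (F.P p.K) k (SU N)) (s : SeqOfRecord F ν M g p.K k)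
    (hT : Integrable (fun U => chiSeqOfRecord F N ν M g p.K k s U * T s U) (fieldMeasure (F.P p.K) k (SU N)))
    (hω : ∀ t : LbOfRecord F ν p g k, Measurable (fun z : GaugeField (F.P p.K) (k + 1) (SU N) × GaugeField (F.P p.K) k (SU N) =>
      ωOfRecord F N ν M p g k A₁ ζ s t z.2 z.1))
    (hχ : ∀ t : LbOfRecord F ν p g k, Measurable (chiSeqOfRecord F N ν M g p.K (k + 1) (σOfRecord F ν M p g k s t))) :
    ∑ t : LbOfRecord F ν p g k, ∫ V', chiSeqOfRecord F N ν M g p.K (k + 1) (σOfRecord F ν M p g k s t) V' *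
        texpASucc (avOfRecord F N p.K k).avg (chiSeqOfRecord F N ν M g p.K k) T
          (fun _ => ωOfRecord F N ν M p g k A₁ ζ s t) (σOfRecord F ν M p g k s t) V' ∂(fieldMeasure (F.P p.K) (k + 1) (SU N)) =
      ∫ U, chiSeqOfRecord F N ν M g p.K k s U * T s U ∂(fieldMeasure (F.P p.K) k (SU N)) := by
  rw [Finset.sum_congr rfl fun t _ => integral_labelPiece F N ν M p g k hk A₁ hζ T s t hT (hω t) (hχ t),
    ← integral_finsetSum _ fun t _ => integrable_labelFine F N ν M p g k A₁ hζ T s t hT (hω t)]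
  refine integral_congr_ae (ae_of_all _ fun U => ?_)
  show ∑ t : LbOfRecord F ν p g k, ωOfRecord F N ν M p g k A₁ ζ s t U ((avOfRecord F N p.K k).avg U) *
      (chiSeqOfRecord F N ν M g p.K k s U * T s U) = _
  rw [← Finset.sum_mul, sum_ωOfRecord_eq_one F N ν M p g k A₁ hζu, one_mul]

/-! ## §3 THE FIRST STEP IN THE TOWER's CURRENCY: the level-1 masses of the pinned label pieces against the level-0 mass -/

/-- **«hrel» AT THE FIRST PINNED STEP, IN THE TOWER's CURRENCY, FOR LABEL-INDEXED CHOICES.**  With the `δ₀ > 0`, `C ≥ 0` of n20-d's cells Peierls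
bound (functions of `N`, `L` only): on every torus `F.P K` (`K ≥ 1`), for `g₀⁻² ≥ 4N`, every `E`, every residual fluctuation factor obeying
`IsZetaAbsLeOne`, every `A₁`, every level-`0` sequence `s`, every finite family `D` of χ₁-cubes with regularity letters on pairwise disjoint regions
`R c` of at most `m` plaquettes and a common `ε″ ≥ 0`, and the DISPLAYED measurabilities of the label weights (O4) and of the new front factors:
the SUM OVER THE PINNED LABEL CHOICES `t` (those whose new large-field family contains `D`) OF THE LEVEL-`1` MASSES OF THEIR 𝐓-PIECES grown from the
one-term representation `ρ₀` of level `0` (`χ_0 ≡ 1`) is at most `(m·e^{Cδ₀ − δ₀g₀⁻²ε″²∕(2N)})^{#D}` times the level-`0` mass `∫ρ₀`: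
`|Σ_{t : D ⊆ P(t)} ∫ χ₁(σ s t)(V′)·(𝐓-piece of t from ρ₀)(V′) dV′| ≤ (m·r)^{#D}·∫ ρ₀(U) dU`
— the shape `Σ_{p ∈ branch ∩ S} ∫ (op p ρ₀) dμ₁ ≤ ε·∫ ρ₀ dμ₀` of `PrefixExtraction.hrel_of_hstep`'s conclusion at `j = 0`, for the choice index =
LABELS, modulo the two letters. [folklore] -/
theorem abs_sum_integral_pinnedLabelPieces_le :
    ∃ δ₀ : ℝ, 0 < δ₀ ∧ ∃ C : ℝ, 0 ≤ C ∧ ∀ (hK : 1 ≤ p.K) (g₀ E : ℝ), 4 * N ≤ g₀⁻¹ ^ 2 →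
      ∀ (A₁ : ℝ) {ζ : ZetaOfRecord F N ν M}, IsZetaAbsLeOne F N ν M ζ →
      ∀ (s : SeqOfRecord F ν M g p.K 0) (D : Finset (Iχ F ν p g 0)) (R : Iχ F ν p g 0 → Finset (Plaq (F.P p.K) 1))
        (m : ℕ) (ε'' : ℝ), 0 ≤ ε'' → (∀ c ∈ D, (R c).card ≤ m) →
        (∀ c₁ ∈ D, ∀ c₂ ∈ D, c₁ ≠ c₂ → Disjoint (R c₁) (R c₂)) →
        (∀ c ∈ D, ∀ V' : GaugeField (F.P p.K) 1 (SU N),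
          (∀ p' ∈ R c, dist1 (GaugeField.plaqHol V' p') < ε'') → chiFactor F N ν p g 0 c V' = 1) →
        (∀ t : LbOfRecord F ν p g 0, Measurable (fun z : GaugeField (F.P p.K) 1 (SU N) × GaugeField (F.P p.K) 0 (SU N) =>
          ωOfRecord F N ν M p g 0 A₁ ζ s t z.2 z.1)) →
        (∀ t : LbOfRecord F ν p g 0, Measurable (chiSeqOfRecord F N ν M g p.K 1 (σOfRecord F ν M p g 0 s t))) →
        |∑ t ∈ Finset.univ.filter (fun t : LbOfRecord F ν p g 0 => D ⊆ t.1),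
            ∫ V', chiSeqOfRecord F N ν M g p.K 1 (σOfRecord F ν M p g 0 s t) V' *
              texpASucc (avOfRecord F N p.K 0).avg (chiSeqOfRecord F N ν M g p.K 0) (fun _ => rhoZeroOfRecord F N p.K g₀ E)
                (fun _ => ωOfRecord F N ν M p g 0 A₁ ζ s t) (σOfRecord F ν M p g 0 s t) V' ∂(fieldMeasure (F.P p.K) 1 (SU N))| ≤
          ((m : ℝ) * Real.exp (C * δ₀ - δ₀ * g₀⁻¹ ^ 2 * (ε'' ^ 2 / (2 * (Fintype.card (Fin N) : ℝ))))) ^ D.card *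
            ∫ U, rhoZeroOfRecord F N p.K g₀ E U ∂(fieldMeasure (F.P p.K) 0 (SU N)) := by
  obtain ⟨δ₀, hδ₀, C, hC, h⟩ := abs_integral_pinnedLargeFamily_rhoZero_le F N ν M p g
  refine ⟨δ₀, hδ₀, C, hC, fun hK g₀ E hg A₁ ζ hζ s D R m ε'' hε hm hdisj hreg hω hχ => ?_⟩
  have hk : 0 < p.K := hK
  have hβ0 : (0 : ℝ) ≤ g₀⁻¹ ^ 2 := sq_nonneg _
  -- the old piece `χ_0(s)·ρ₀` is integrable (`χ_0 ≡ 1`)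
  have hρi : Integrable (rhoZeroOfRecord F N p.K g₀ E) (fieldMeasure (F.P p.K) 0 (SU N)) :=
    (Missing.integrable_boltzmann RegularGaugeGroup.measurable_reTr (F.P p.K) hβ0).const_mul _
  have hT : Integrable (fun U => chiSeqOfRecord F N ν M g p.K 0 s U * (fun _ => rhoZeroOfRecord F N p.K g₀ E) s U)
      (fieldMeasure (F.P p.K) 0 (SU N)) := by
    refine hρi.congr (ae_of_all _ fun U => ?_)
    simp only [chiSeqOfRecord_zero, one_mul]
  -- each pinned label piece has level-1 mass = the graph integral of `ω s t (U,Ū)·ρ₀(U)`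
  have hpiece : ∀ t : LbOfRecord F ν p g 0,
      ∫ V', chiSeqOfRecord F N ν M g p.K 1 (σOfRecord F ν M p g 0 s t) V' *
          texpASucc (avOfRecord F N p.K 0).avg (chiSeqOfRecord F N ν M g p.K 0) (fun _ => rhoZeroOfRecord F N p.K g₀ E)
            (fun _ => ωOfRecord F N ν M p g 0 A₁ ζ s t) (σOfRecord F ν M p g 0 s t) V' ∂(fieldMeasure (F.P p.K) 1 (SU N)) =
        ∫ U, ωOfRecord F N ν M p g 0 A₁ ζ s t U ((avOfRecord F N p.K 0).avg U) * rhoZeroOfRecord F N p.K g₀ E U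
          ∂(fieldMeasure (F.P p.K) 0 (SU N)) := by
    intro t
    rw [integral_labelPiece F N ν M p g 0 hk A₁ hζ (fun _ => rhoZeroOfRecord F N p.K g₀ E) s t hT (hω t) (hχ t)]
    refine integral_congr_ae (ae_of_all _ fun U => ?_)
    simp only [chiSeqOfRecord_zero, one_mul]
  have hint : ∀ t : LbOfRecord F ν p g 0,
      Integrable (fun U => ωOfRecord F N ν M p g 0 A₁ ζ s t U ((avOfRecord F N p.K 0).avg U) * rhoZeroOfRecord F N p.K g₀ E U)
        (fieldMeasure (F.P p.K) 0 (SU N)) := by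
    intro t
    refine (integrable_labelFine F N ν M p g 0 A₁ hζ (fun _ => rhoZeroOfRecord F N p.K g₀ E) s t hT (hω t)).congr
      (ae_of_all _ fun U => ?_)
    simp only [chiSeqOfRecord_zero, one_mul]
  rw [Finset.sum_congr rfl fun t _ => hpiece t, ← integral_finsetSum _ fun t _ => hint t]
  have hsum : ∀ U, ∑ t ∈ Finset.univ.filter (fun t : LbOfRecord F ν p g 0 => D ⊆ t.1),
      ωOfRecord F N ν M p g 0 A₁ ζ s t U ((avOfRecord F N p.K 0).avg U) * rhoZeroOfRecord F N p.K g₀ E U =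
        (∑ t ∈ Finset.univ.filter (fun t : LbOfRecord F ν p g 0 => D ⊆ t.1),
          ωOfRecord F N ν M p g 0 A₁ ζ s t U ((avOfRecord F N p.K 0).avg U)) * rhoZeroOfRecord F N p.K g₀ E U :=
    fun U => (Finset.sum_mul _ _ _).symm
  rw [integral_congr_ae (ae_of_all _ hsum)]
  exact h hK g₀ E hg A₁ hζ s D R m ε'' hε hm hdisj hreg

end Summit.QuantumFields.YangMills.BalabanUVNodes.N20LCSLabelPieces

end

/-! ### Erratum (g4, 2026-08-27) — citation pointer, prose only
In the prose of this file «[Balaban1985PropagatorsII] Thm 1» ∕ «CMP 99 (1985) 389–434» denotes T. Bałaban, *The variational problem and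
background fields in renormalization group method for lattice gauge theories*, Commun. Math. Phys. **102** (1985) 277–309 — bib key
`Balaban1985Variational` —, Theorem 1 p. 279 (for data with `|∂V(p′) − 1| < ε₁ ≤ a₁` there is a minimal orbit in
`U_k({𝔅_j}, B₃ε₁) ∩ 𝔘_k(𝔅_k, V)`, the unique critical orbit for `B₃ε₁ ≤ ε₀ ≤ a₀`, with the local regularity (9)–(10)); there is no bib key
`Balaban1985PropagatorsII`.  The regularity letter `hreg` is that theorem's shape at def-R's (2.16) problem.  Statements are unaffected. -/
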